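import Literature.MathematicalPhysics.QuantumLattice.HubbardLangerMattisTorus
import Literature.MathematicalPhysics.QuantumLattice.HartreeFockFreeFermionThermodynamicLimit
import Literature.MathematicalPhysics.QuantumLattice.HubbardAtomicLimit
import HarnessLib

/-!
# The free-fermion (kinetic) lower bound for the repulsive Hubbard model

Family `hubbard` (trunk T-QLATTICE); written for the certified-numerics cell `pub-mbboot`
(request of the adversarial seat `adv-1`: a tree-backed LOWER endpoint for the doped
thermodynamic-limit energy density that is as tight as the free Fermi sea).

For `U ≥ 0` the repulsion `U Σ_x n_{x↑} n_{x↓}` is a nonnegative operator, so the Hubbard energy is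
bounded below by the free kinetic energy; and the kinetic energy of ONE spin species in ANY Fock
vector is at least `μ ⟨N_σ⟩ + Σ_i min(λ_i - μ, 0) ‖ψ‖²` for every chemical potential `μ`, where
`λ_i` are the eigenvalues of the one-body hopping matrix `-t A_G` (each eigenmode is occupied with a
weight in `[0, ‖ψ‖²]`; Lieb–Loss' bathtub principle). Hence, on every finite graph,

  `E_G(t, U; N) ≥ μ N + 2 Σ_i min(λ_i(-t A_G) - μ, 0)`      (`FreeKinetic.groundEnergyAt_ge`),

on the torus `(ℤ/Lℤ)^d`, `L ≥ 3`, with the plane-wave levels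
`ε(c_z) = 2t Σ_i cos (c_z)_i`, `c_z = 2πz/L - (π,…,π)` (`sdwBand t (cellCorner z)`),

  `E_L(N) ≥ μ N + 2 Σ_z min(ε(c_z) - μ, 0)`      (`FreeKinetic.hubbardTorus_groundEnergyAt_ge`),

and in the thermodynamic limit on the square lattice, for `U ≥ 0`, `0 ≤ n < 2` and every `μ`,

  `energyDensity2D t U n ≥ μ n + 2 (2π)⁻² ∫_{[-π,π]²} min(2t(cos p₁ + cos p₂) - μ, 0) dp`
                                                   (`FreeKinetic.energyDensity2D_ge`).

Optimising over `μ` gives the free Fermi-sea energy at density `n` (Legendre duality); the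
statement is kept with a free `μ` so that a certificate only has to enclose one integral.

## References

* E. H. Lieb, M. Loss, *Analysis* (2nd ed., 2001), Thm 1.14 (bathtub principle); E. H. Lieb,
  M. Loss, Duke Math. J. 71 (1993) 337, §8 (sum of negative eigenvalues bounds `dΓ`).
  [LiebLoss1993]
* V. Bach, E. H. Lieb, J. P. Solovej, J. Stat. Phys. 76 (1994) 3, eq. (2c.36) (the free/Hartree–Fock
  functional; here only its trivial lower half `U Σ n↑n↓ ≥ 0`). [BachLiebSolovej1994]
* S. Friedli, Y. Velenik, *Statistical Mechanics of Lattice Systems* (2017), §10.5.2 (plane waves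
  on the torus, Riemann sums). [FriedliVelenikSMLS2017]
-/

noncomputable section

namespace Literature.MathematicalPhysics.QuantumLattice

namespace FreeKinetic

open Matrix Finset Filter Topology Literature.Probability.LatticeModels
  Literature.MathematicalPhysics.QuantumLattice.RayleighBound
  Literature.MathematicalPhysics.QuantumLattice.HubbardBandBottom
  Literature.MathematicalPhysics.QuantumLattice.LangerMattis
  Literature.MathematicalPhysics.QuantumLattice.HartreeFock ThermodynamicLimit
open scoped ComplexOrder ComplexConjugate Topology

/-! ### Any finite graph -/

section Graph

variable {Λ : Type*} [LinearOrder Λ] [Fintype Λ] (G : SimpleGraph Λ) [DecidableRel G.Adj]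

/-- `dΓ_σ(t A_G) = t T_σ`: the second quantisation of the hopping matrix is the hopping operator.
[cite: LiebLoss1993, §8 eq. (8.1)] -/
theorem dGammaSpin_hopMatrix (t : ℝ) (σ : Fin 2) :
    dGammaSpin σ (hopMatrix G t) = (t : ℂ) • hopOp G σ := by
  simp only [dGammaSpin, hopMatrix, Matrix.of_apply, ite_smul, zero_smul, hopOp, Finset.smul_sum,
    smul_ite, smul_zero]

/-- `H_σ = dΓ_σ(-t A_G) + (U/2) Σ_x n_{x↑} n_{x↓}`. [cite: LangerMattis1971, eq. (5)] -/
theorem speciesHamiltonian_eq (t U : ℝ) (σ : Fin 2) :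
    speciesHamiltonian G t U σ =
      dGammaSpin σ (hopMatrix G (-t)) + ((U / 2 : ℝ) : ℂ) • ∑ x : Λ, numberOp x 0 * numberOp x 1 := by
  rw [speciesHamiltonian, dGammaSpin_hopMatrix, Complex.ofReal_neg]

/-- The repulsion is a nonnegative operator: `0 ≤ Re ⟨ψ, Σ_x n_{x↑} n_{x↓} ψ⟩` (it is diagonal with
entries the number of doubly occupied sites). [folklore] -/
theorem re_rayleigh_interaction_nonneg (ψ : Fock (Orb Λ)) :
    0 ≤ (star ψ ⬝ᵥ ((∑ x : Λ, numberOp x 0 * numberOp x 1) *ᵥ ψ)).re := by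
  rw [sum_numberOp_mul_numberOp_eq_diagonal, dotProduct, Complex.re_sum]
  refine Finset.sum_nonneg fun s _ => ?_
  rw [mulVec_diagonal, Pi.star_apply, ← mul_assoc, mul_comm (star (ψ s)), mul_assoc,
    Complex.star_def, Complex.conj_mul']
  have h : (((doublyOccupied s).card : ℂ) * ((‖ψ s‖ : ℂ) ^ 2)) =
      ((((doublyOccupied s).card : ℝ) * ‖ψ s‖ ^ 2 : ℝ) : ℂ) := by push_cast; ring
  rw [h, Complex.ofReal_re]
  positivity

variable {G} in
/-- **One-body bound with a chemical potential.** For a Hermitian site matrix `A` with levels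
`λ_i`, every `μ` and every Fock vector `φ`:
`Σ_i min(λ_i - μ, 0) ‖φ‖² + μ Re ⟨φ, N_σ φ⟩ ≤ Re ⟨φ, dΓ_σ(A) φ⟩`
(the rotated occupations `n_i = ‖c(v_i ⊗ e_σ) φ‖²` lie in `[0, ‖φ‖²]` and sum to `⟨N_σ⟩`; so
`Σ λ_i n_i = μ Σ n_i + Σ (λ_i - μ) n_i ≥ μ⟨N_σ⟩ + Σ min(λ_i - μ, 0)‖φ‖²`).
[cite: LiebLoss1993, §8, proof of Theorem 8.2] -/
theorem sum_min_sub_mul_normSq_le (σ : Fin 2) {A : Matrix Λ Λ ℂ} (hA : A.IsHermitian) (μ : ℝ)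
    (φ : Fock (Orb Λ)) :
    (∑ i, min (hA.eigenvalues i - μ) 0) * normSq φ +
        μ * (star φ ⬝ᵥ ((∑ x : Λ, numberOp x σ) *ᵥ φ)).re ≤
      (star φ ⬝ᵥ (dGammaSpin σ A *ᵥ φ)).re := by
  classical
  set V : Matrix Λ Λ ℂ := (hA.eigenvectorUnitary : Matrix Λ Λ ℂ) with hVdef
  have hVV : V * star V = 1 := Matrix.mem_unitaryGroup_iff.1 hA.eigenvectorUnitary.2
  have hVV' : star V * V = 1 := Matrix.mem_unitaryGroup_iff'.1 hA.eigenvectorUnitary.2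
  set v : Λ → Λ → ℂ := fun k x => V x k with hvdef
  have hv : ∀ x y : Λ, ∑ k, v k x * star (v k y) = if x = y then 1 else 0 := fun x y => by
    have h := congrFun (congrFun hVV x) y
    simp only [Matrix.mul_apply, Matrix.star_apply, Matrix.one_apply] at h
    exact h
  have hon : ∀ k l, star (v k) ⬝ᵥ v l = if k = l then 1 else 0 := fun k l => by
    have h := congrFun (congrFun hVV' k) l
    simp only [Matrix.mul_apply, Matrix.star_apply, Matrix.one_apply] at h
    rw [dotProduct]
    simpa only [Pi.star_apply] using h
  have heig : ∀ k, A *ᵥ v k = ((hA.eigenvalues k : ℝ) : ℂ) • v k := fun k => by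
    have hcol : v k = ⇑(hA.eigenvectorBasis k) := by
      funext x
      show V x k = _
      rw [hVdef, Matrix.IsHermitian.eigenvectorUnitary_apply]
    rw [hcol, hA.mulVec_eigenvectorBasis k]
    funext x
    simp only [Pi.smul_apply, Complex.real_smul, smul_eq_mul]
  have heig1 : ∀ k, (1 : Matrix Λ Λ ℂ) *ᵥ v k = (((1 : ℝ) : ℝ) : ℂ) • v k := fun k => by
    rw [one_mulVec, Complex.ofReal_one, one_smul]
  set w : Λ × Fin 2 → Orb Λ → ℂ := fun p o => if (ofLex o).2 = p.2 then v p.1 (ofLex o).1 else 0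
    with hwdef
  have hw : ∀ p o, w p o = if (ofLex o).2 = p.2 then v p.1 (ofLex o).1 else 0 := fun p o => rfl
  have hN : (star φ ⬝ᵥ ((∑ x : Λ, numberOp x σ) *ᵥ φ)).re =
      ∑ k, normSq (annihilate (w (k, σ)) *ᵥ φ) := by
    rw [← dGammaSpin_one, re_rayleigh_dGammaSpin_eq_sum σ 1 v (fun _ => (1 : ℝ)) hv heig1 w hw φ]
    simp only [one_mul]
  rw [re_rayleigh_dGammaSpin_eq_sum σ A v hA.eigenvalues hv heig w hw φ, hN, Finset.sum_mul,
    Finset.mul_sum, ← Finset.sum_add_distrib]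
  refine Finset.sum_le_sum fun k _ => ?_
  have h0 : 0 ≤ normSq (annihilate (w (k, σ)) *ᵥ φ) := normSq_nonneg _
  have h1 : normSq (annihilate (w (k, σ)) *ᵥ φ) ≤ normSq φ :=
    normSq_annihilate_mulVec_le (spinMode_unit v hon w hw (k, σ)) φ
  rcases le_or_gt 0 (hA.eigenvalues k - μ) with hk | hk
  · rw [min_eq_right hk, zero_mul, zero_add]
    nlinarith
  · rw [min_eq_left hk.le]
    nlinarith

/-- **Free kinetic lower bound on Fock space.** For `U ≥ 0`, every `μ` and every Fock vector `ψ`: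
`μ Re ⟨ψ, N ψ⟩ + 2 (Σ_i min(λ_i(-tA_G) - μ, 0)) ‖ψ‖² ≤ Re ⟨ψ, H(t,U) ψ⟩`.
[cite: LiebLoss1993, §8, Theorem 8.2] -/
theorem re_rayleigh_hamiltonian_ge (t : ℝ) {U : ℝ} (hU : 0 ≤ U) (μ : ℝ) (ψ : Fock (Orb Λ)) :
    μ * (star ψ ⬝ᵥ (totalNumber *ᵥ ψ)).re +
        2 * (∑ i, min ((isHermitian_hopMatrix G (-t)).eigenvalues i - μ) 0) * normSq ψ ≤
      (star ψ ⬝ᵥ (hamiltonian G t U *ᵥ ψ)).re := by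
  have hD := re_rayleigh_interaction_nonneg ψ
  have h0 := sum_min_sub_mul_normSq_le (σ := 0) (isHermitian_hopMatrix G (-t)) μ ψ
  have h1 := sum_min_sub_mul_normSq_le (σ := 1) (isHermitian_hopMatrix G (-t)) μ ψ
  have hsp : ∀ σ : Fin 2, (star ψ ⬝ᵥ (speciesHamiltonian G t U σ *ᵥ ψ)).re =
      (star ψ ⬝ᵥ (dGammaSpin σ (hopMatrix G (-t)) *ᵥ ψ)).re +
        U / 2 * (star ψ ⬝ᵥ ((∑ x : Λ, numberOp x 0 * numberOp x 1) *ᵥ ψ)).re := fun σ => by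
    rw [speciesHamiltonian_eq, add_mulVec, dotProduct_add, Complex.add_re, Matrix.smul_mulVec,
      dotProduct_smul, smul_eq_mul, Complex.re_ofReal_mul]
  rw [hamiltonian_eq_add_speciesHamiltonian, add_mulVec, dotProduct_add, Complex.add_re, hsp 0, hsp 1,
    totalNumber_eq_add, add_mulVec, dotProduct_add, Complex.add_re]
  have hU2 : 0 ≤ U / 2 * (star ψ ⬝ᵥ ((∑ x : Λ, numberOp x 0 * numberOp x 1) *ᵥ ψ)).re :=
    mul_nonneg (by linarith) hD
  linarith

/-- **Free kinetic lower bound for the Hubbard ground-state energy on a finite graph.** For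
`U ≥ 0`, every `μ` and every `N ≤ 2|Λ|`:

  `μ N + 2 Σ_i min(λ_i(-t A_G) - μ, 0) ≤ groundEnergyAt G t U N`.

[cite: LiebLoss1993, §8, Theorem 8.2] -/
theorem groundEnergyAt_ge (t : ℝ) {U : ℝ} (hU : 0 ≤ U) (μ : ℝ) {N : ℕ}
    (hN : N ≤ 2 * Fintype.card Λ) :
    μ * N + 2 * ∑ i, min ((isHermitian_hopMatrix G (-t)).eigenvalues i - μ) 0 ≤
      groundEnergyAt G t U N := by
  obtain ⟨ψ, hψN, hψ1, hHψ⟩ := ThermodynamicLimit.exists_unit_groundState G t U hN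
  have hnorm : normSq ψ = 1 := by
    have h := star_dotProduct_self_eq_normSq ψ
    rw [hψ1] at h
    exact_mod_cast h.symm
  have hE : (star ψ ⬝ᵥ (hamiltonian G t U *ᵥ ψ)).re = groundEnergyAt G t U N := by
    rw [hHψ, dotProduct_smul, hψ1, smul_eq_mul, mul_one, Complex.ofReal_re]
  have hNum : (star ψ ⬝ᵥ (totalNumber *ᵥ ψ)).re = N := by
    rw [totalNumber_mulVec_of_isNParticle hψN, dotProduct_smul, hψ1, smul_eq_mul, mul_one,
      Complex.natCast_re]
  have h := re_rayleigh_hamiltonian_ge G t hU μ ψ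
  rw [hE, hNum, hnorm, mul_one] at h
  exact h

end Graph

/-! ### The torus -/

section Torus

variable {d L : ℕ} [NeZero L]

/-- **Free kinetic lower bound on the torus.** On `(ℤ/Lℤ)^d`, `L ≥ 3`, for `U ≥ 0`, every `μ` and
every `N ≤ 2L^d`:
`μ N + 2 Σ_z min(2tΣᵢcos(c_z)ᵢ - μ, 0) ≤ E_L(N)`, `c_z = 2πz/L - (π,…,π)`
(the plane wave of momentum `2πz/L` has kinetic energy `-2tΣᵢcos(2πzᵢ/L) = 2tΣᵢcos((c_z)ᵢ)`).
[cite: FriedliVelenikSMLS2017, §10.5.2][cite: LiebLoss1993, §8, Theorem 8.2] -/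
theorem hubbardTorus_groundEnergyAt_ge (hL : 3 ≤ L) (t : ℝ) {U : ℝ} (hU : 0 ≤ U) (μ : ℝ) {N : ℕ}
    (hN : N ≤ 2 * L ^ d) :
    μ * N + 2 * ∑ z : TorusSite d L, min (sdwBand t (cellCorner z) - μ) 0 ≤
      groundEnergyAt (fermionTorusGraph d L) t U N := by
  have hcard : Fintype.card (FermionTorus d L) = L ^ d := card_fermionTorus_eq
  have h := groundEnergyAt_ge (fermionTorusGraph d L) t hU μ (N := N) (by rw [hcard]; exact hN)
  have h2 := sum_eigenvalues_hopMatrix_torus (d := d) hL (-t) (fun x => min (x - μ) 0)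
  have hs : ∑ k : TorusSite d L, min (-t * (2 * ∑ i, Real.cos (latticeMomentum L k i)) - μ) 0 =
      ∑ z : TorusSite d L, min (sdwBand t (cellCorner z) - μ) 0 := by
    refine Finset.sum_congr rfl fun z _ => ?_
    rw [← siteBand_neg_ofTorusSite_eq_sdwBand, siteBand_neg_ofTorusSite, neg_mul]
  rw [← hs, ← h2]
  convert h using 8

end Torus

/-! ### Thermodynamic limit on the square lattice -/

section Thermodynamic

/-- The free kinetic integrand `min(2t(cos p₁ + … ) - μ, 0)` is continuous. [folklore] -/
theorem continuous_min_sdwBand_sub {d : ℕ} (t μ : ℝ) :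
    Continuous fun p : Fin d → ℝ => min (sdwBand t p - μ) 0 :=
  ((continuous_sdwBand t).sub continuous_const).min continuous_const

/-- **Free kinetic lower bound for the square-lattice Hubbard energy density at arbitrary
filling.** For `U ≥ 0`, `0 ≤ n < 2` and every chemical potential `μ`:

  `μ n + 2 (2π)⁻² ∫_{[-π,π]²} min(2t(cos p₁ + cos p₂) - μ, 0) dp ≤ energyDensity2D t U n`

(the repulsion is nonnegative and the free Fermi sea is the kinetic minimum; the supremum over `μ`
of the left-hand side is the free-fermion energy density at filling `n`). Obtained from
`hubbardTorus_groundEnergyAt_ge` along the tori `L ≥ 3`, `N_L(n)/L² → n` and the convergence of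
the corner Riemann sums (`tendsto_cornerRiemannSum`). [cite: LiebLoss1993, §8, Theorem 8.2] -/
theorem energyDensity2D_ge (t : ℝ) {U : ℝ} (hU : 0 ≤ U) {n : ℝ} (hn0 : 0 ≤ n) (hn2 : n < 2)
    (μ : ℝ) :
    μ * n + 2 * (((2 * Real.pi) ^ 2)⁻¹ * ∫ p in brillouin 2, min (sdwBand t p - μ) 0) ≤
      energyDensity2D t U n := by
  -- tori `L = m + 3`
  set φ : ℕ → ℕ := fun m => m + 3 with hφdef
  have hφ : Tendsto φ atTop atTop :=
    tendsto_atTop_atTop.2 fun b => ⟨b, fun m hm => by simp only [hφdef]; omega⟩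
  have hlim : Tendsto (fun m => groundEnergyAt (fermionTorusGraph 2 (φ m)) t U (rectN n (φ m)) /
      ((φ m : ℕ) : ℝ) ^ 2) atTop (𝓝 (energyDensity2D t U n)) :=
    (tendsto_energyDensity2D_torus t hU hn0 hn2).comp hφ
  set F : (Fin 2 → ℝ) → ℝ := fun p => min (sdwBand t p - μ) 0 with hFdef
  have hF : ContinuousOn F (brillouin 2) := (continuous_min_sdwBand_sub t μ).continuousOn
  have hRS : Tendsto (fun m => ((2 * Real.pi) ^ 2)⁻¹ * cornerRiemannSum F (φ m))
      atTop (𝓝 (((2 * Real.pi) ^ 2)⁻¹ * ∫ p in brillouin 2, F p)) :=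
    ((tendsto_cornerRiemannSum hF).comp hφ).const_mul _
  have hN : Tendsto (fun m => μ * ((rectN n (φ m) : ℝ) / ((φ m : ℕ) : ℝ) ^ 2)) atTop
      (𝓝 (μ * n)) :=
    ((tendsto_rectN_div_sq hn0).comp hφ).const_mul _
  have hb : Tendsto (fun m => μ * ((rectN n (φ m) : ℝ) / ((φ m : ℕ) : ℝ) ^ 2) +
      2 * (((2 * Real.pi) ^ 2)⁻¹ * cornerRiemannSum F (φ m))) atTop
      (𝓝 (μ * n + 2 * (((2 * Real.pi) ^ 2)⁻¹ * ∫ p in brillouin 2, F p))) :=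
    hN.add (hRS.const_mul 2)
  refine le_of_tendsto_of_tendsto hb hlim (Eventually.of_forall fun m => ?_)
  -- the finite-volume inequality on the torus of side `L = m + 3`, divided by `L²`
  dsimp only
  have hL3 : 3 ≤ φ m := by simp only [hφdef]; omega
  haveI : NeZero (φ m) := ⟨by omega⟩
  have hL2 : (0 : ℝ) < ((φ m : ℕ) : ℝ) ^ 2 := by
    have hLpos : (0 : ℝ) < ((φ m : ℕ) : ℝ) := by exact_mod_cast (show 0 < φ m by omega)
    positivity
  have hNle : rectN n (φ m) ≤ 2 * φ m ^ 2 := by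
    have := rectN_le_two_mul hn0 hn2.le (φ m)
    rwa [sq]
  have h := hubbardTorus_groundEnergyAt_ge (d := 2) hL3 t hU μ hNle
  rw [← sum_cellCorner_div_eq, le_div_iff₀ hL2]
  have key : (μ * ((rectN n (φ m) : ℝ) / ((φ m : ℕ) : ℝ) ^ 2) +
      2 * ((∑ z : TorusSite 2 (φ m), F (cellCorner z)) / ((φ m : ℕ) : ℝ) ^ 2)) *
        ((φ m : ℕ) : ℝ) ^ 2 =
      μ * (rectN n (φ m) : ℝ) + 2 * ∑ z : TorusSite 2 (φ m), F (cellCorner z) := by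
    field_simp
  rw [key]
  exact h

end Thermodynamic

end FreeKinetic

/-- The free kinetic lower bound under the name and signature used by the `pub-mbboot` certificate
files (`kinetic_lower` endpoints): for `U ≥ 0`, `0 ≤ n < 2` and every `μ`,
`μ n + 2 (2π)⁻² ∫_{[-π,π]²} min(2t(cos p₁ + cos p₂) - μ, 0) dp ≤ energyDensity2D t U n`.
[cite: LiebLoss1993, §8, Theorem 8.2] -/
theorem ThermodynamicLimit.energyDensity2D_ge_freeKinetic (t U : ℝ) (hU : 0 ≤ U) {n : ℝ}
    (hn0 : 0 ≤ n) (hn2 : n < 2) (μ : ℝ) :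
    μ * n + 2 * (((2 * Real.pi) ^ 2)⁻¹ *
        ∫ p in Literature.Probability.LatticeModels.brillouin 2, min (HartreeFock.sdwBand t p - μ) 0) ≤
      ThermodynamicLimit.energyDensity2D t U n :=
  FreeKinetic.energyDensity2D_ge t hU hn0 hn2 μ

end Literature.MathematicalPhysics.QuantumLattice
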